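import Summits.Ventures.DiscreteObjects.PP12.OrderElevenHomologyWalkRuns
import Summits.Ventures.DiscreteObjects.PP12.OrderElevenHomologyScanSound
import Summits.Ventures.DiscreteObjects.PP12.OrderElevenHomologyForced

/-!
# PP(12), order-11 cell, Case A: SOUNDNESS of the completeness walks (designs g22)
Framing: lottery ticket; floor = certified bounds/negative ranges.

Cell pub-namedobj (venture DiscreteObjects), target (M), P11-SIZING.md. If a walk `Homology12.walk i f j usedV usedD pv L` (OrderElevenHomologyWalk) succeeds
from a state that describes the TRUE prefix of row `i` of a normal array `a` (`pv` = packed prefix, every used value / used difference witnessed by an earlier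
column), then the packed row `packRow a i` is a member of `L` (`walk_mem`): the walk only ever consumes heads of the list (`walk_suffix`), the true digit
passes every filter (injectivity, non-zero fresh difference with row `0` — `IsNormal.latin/ne_of_ne/diff_ne/row0`), and at full length the head test must hit
the packed row. With the forced digits (`IsNormal.col0`) the 18 walks of OrderElevenHomologyWalkRuns give **`packRow_one_mem : packRow a 1 ∈ CANDS2`** and
**`packRow_two_mem : packRow a 2 ∈ CANDS3`**. No `sorry`, no new axioms; nothing here asserts a census statement.
-/

set_option maxRecDepth 100000

namespace Summit.Ventures.DiscreteObjects.PP12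

namespace Homology12

open List in
/-- a successful step only consumes heads -/
theorem stepV_suffix {j uV uD pv : ℕ} {W : ℕ → ℕ → ℕ → List ℕ → Option (List ℕ)}
    (hW : ∀ a b c (R R1 : List ℕ), W a b c R = some R1 → R1 <:+ R) {v : ℕ} {R R1 : List ℕ}
    (h : stepV j uV uD pv W v R = some R1) : R1 <:+ R := by
  unfold stepV at h
  split_ifs at h
  · cases h; exact suffix_refl _
  · exact hW _ _ _ _ _ h
  · cases h; exact suffix_refl _
  · exact hW _ _ _ _ _ h

open List in
/-- a successful value loop only consumes heads -/
theorem walkV_suffix {j uV uD pv : ℕ} {W : ℕ → ℕ → ℕ → List ℕ → Option (List ℕ)}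
    (hW : ∀ a b c (R R1 : List ℕ), W a b c R = some R1 → R1 <:+ R) :
    ∀ (n : ℕ) (R R1 : List ℕ), walkV j uV uD pv W n R = some R1 → R1 <:+ R
  | 0, R, R1, h => by rw [walkV] at h; cases h; exact suffix_refl _
  | n + 1, R, R1, h => by
    rw [walkV] at h
    cases hs : stepV j uV uD pv W (10 - n) R with
    | none => rw [hs] at h; exact absurd h (by simp)
    | some R2 =>
      rw [hs] at h
      exact (walkV_suffix hW n R2 R1 h).trans (stepV_suffix hW hs)

open List in
/-- **a successful walk only consumes heads of the list** -/
theorem walk_suffix (i : ℕ) : ∀ (f j uV uD pv : ℕ) (R R1 : List ℕ), walk i f j uV uD pv R = some R1 → R1 <:+ R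
  | 0, j, uV, uD, pv, R, R1, h => by
    cases R with
    | nil => simp [walk] at h
    | cons x R' =>
      simp only [walk] at h
      split_ifs at h
      cases h; exact suffix_cons _ _
  | f + 1, j, uV, uD, pv, R, R1, h => by
    simp only [walk] at h
    split_ifs at h
    · exact walk_suffix i f _ _ _ _ _ _ h
    · exact walkV_suffix (fun a b c R R1 h' => walk_suffix i f _ _ _ _ _ _ h') 11 R R1 h

/-- the value loop reaches the true digit `v* ≤ 10`: if the step at `v*` certifies membership whenever it succeeds, so does the loop from any `n` with `11 − n ≤ v*` -/
theorem walkV_mem {j uV uD pv : ℕ} {W : ℕ → ℕ → ℕ → List ℕ → Option (List ℕ)} {P vs : ℕ} (hvs : vs ≤ 10)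
    (hW : ∀ a b c (R R1 : List ℕ), W a b c R = some R1 → R1 <:+ R)
    (HT : ∀ R R1 : List ℕ, stepV j uV uD pv W vs R = some R1 → P ∈ R) :
    ∀ (n : ℕ) (R R1 : List ℕ), 11 - n ≤ vs → walkV j uV uD pv W n R = some R1 → P ∈ R
  | 0, R, R1, hn, _ => by omega
  | n + 1, R, R1, hn, h => by
    rw [walkV] at h
    cases hs : stepV j uV uD pv W (10 - n) R with
    | none => rw [hs] at h; exact absurd h (by simp)
    | some R2 =>
      rw [hs] at h
      by_cases he : 10 - n = vs
      · rw [he] at hs; exact HT R R2 hs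
      · have := walkV_mem hvs hW HT n R2 R1 (by omega) h
        exact (stepV_suffix hW hs).subset this

/-- the state of a walk describes the true prefix of row `i` of `a` below column `j` -/
structure WInv (a : Fin 12 → Fin 12 → ZMod 11) (i : Fin 12) (j uV uD pv : ℕ) : Prop where
  /-- the packed prefix -/
  pv_eq : pv = pack16 (rowDigit a i) j
  /-- used values are earlier entries -/
  usedV : ∀ v, uV.testBit v = true → ∃ j' : Fin 12, (j' : ℕ) < j ∧ j' ≠ i ∧ (a i j').val = v
  /-- used differences are earlier differences with row `0` -/
  usedD : ∀ d, uD.testBit d = true → ∃ j' : Fin 12, 1 ≤ (j' : ℕ) ∧ (j' : ℕ) < j ∧ j' ≠ i ∧ (a i j' - a 0 j').val = d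

/-- row `0` values: `(a 0 j).val = j − 1` for `j ≠ 0` -/
theorem IsNormal.row0_val {a : Fin 12 → Fin 12 → ZMod 11} (ha : IsNormal a) (j : Fin 12) (hj : j ≠ 0) : (a 0 j).val = (j : ℕ) - 1 := by
  have h := ha.row0 j hj
  have hj1 : 1 ≤ (j : ℕ) := Nat.one_le_iff_ne_zero.2 fun e => hj (Fin.ext e)
  have : a 0 j = (((j : ℕ) - 1 : ℕ) : ZMod 11) := by
    rw [Nat.cast_sub hj1, Nat.cast_one]; linear_combination h
  rw [this, ZMod.val_natCast]
  exact Nat.mod_eq_of_lt (by have := j.2; omega)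

/-- **SOUNDNESS OF THE WALK**: from a state describing the true prefix of row `i ≠ 0` of a normal array, a successful walk has the packed row in its list -/
theorem walk_mem {a : Fin 12 → Fin 12 → ZMod 11} (ha : IsNormal a) {i : Fin 12} (hi : i ≠ 0) :
    ∀ (f j uV uD pv : ℕ) (R R1 : List ℕ), WInv a i j uV uD pv → f + j = 12 → walk i f j uV uD pv R = some R1 → packRow a i ∈ R
  | 0, j, uV, uD, pv, R, R1, hI, hf, h => by
    cases R with
    | nil => simp [walk] at h
    | cons x R' =>
      simp only [walk] at h
      split_ifs at h with hx
      rw [beq_iff_eq] at hx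
      rw [hx, hI.pv_eq, show j = 12 by omega]
      exact List.mem_cons_self ..
  | f + 1, j, uV, uD, pv, R, R1, hI, hf, h => by
    have hj : j < 12 := by omega
    simp only [walk] at h
    split_ifs at h with hji
    · -- the hole
      rw [beq_iff_eq] at hji
      refine walk_mem ha hi f (j + 1) uV uD pv R R1 ⟨?_, ?_, ?_⟩ (by omega) h
      · rw [hI.pv_eq, pack16]
        have : rowDigit a i j = 0 := by
          unfold rowDigit; rw [dif_pos hj, if_pos (Fin.ext (by simpa using hji))]
        rw [this]; ring
      · intro v hv; obtain ⟨j', h1, h2, h3⟩ := hI.usedV v hv; exact ⟨j', by omega, h2, h3⟩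
      · intro d hd; obtain ⟨j', h0, h1, h2, h3⟩ := hI.usedD d hd; exact ⟨j', h0, by omega, h2, h3⟩
    · -- a real column: the loop reaches the true digit
      rw [beq_iff_eq] at hji
      set jj : Fin 12 := ⟨j, hj⟩ with hjj
      have hjji : jj ≠ i := fun e => hji (by rw [← e])
      set vs := (a i jj).val with hvs
      have hvs10 : vs ≤ 10 := by have := (a i jj).val_lt; omega
      have hW := fun a' b c R R1 h' => walk_suffix (i : ℕ) f (j + 1) a' b c R R1 h'
      refine walkV_mem hvs10 hW ?_ 11 R R1 (by omega) h
      -- the step at the true digit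
      intro R0 R2 hs
      unfold stepV at hs
      -- the true value is not used
      have hV : uV.testBit vs = false := by
        cases e : uV.testBit vs
        · rfl
        · obtain ⟨j', h1, h2, h3⟩ := hI.usedV vs e
          have hne : j' ≠ jj := fun ee => by rw [ee] at h1; exact lt_irrefl _ h1
          exact absurd (ZMod.val_injective 11 (h3.trans hvs)) (ha.latin i j' jj h2 hjji hne)
      rw [hV] at hs
      simp only [Bool.false_eq_true, if_false] at hs
      have hdig : rowDigit a i j = vs := by
        unfold rowDigit; rw [dif_pos hj, if_neg hjji]
      by_cases hj0 : j = 0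
      · -- column 0: no difference condition
        have hc : (j == 0) = true := by simp [hj0]
        rw [if_pos hc] at hs
        refine walk_mem ha hi f (j + 1) _ _ _ R0 R2 ⟨?_, ?_, ?_⟩ (by omega) hs
        · rw [hI.pv_eq, pack16, hdig]
        · intro v hv
          rw [Nat.testBit_or, Nat.one_shiftLeft, Nat.testBit_two_pow, Bool.or_eq_true, decide_eq_true_eq] at hv
          rcases hv with hv | hv
          · obtain ⟨j', h1, h2, h3⟩ := hI.usedV v hv; exact ⟨j', by omega, h2, h3⟩
          · exact ⟨jj, by simp [hjj], hjji, by rw [← hv]⟩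
        · intro d hd; obtain ⟨j', h0, h1, h2, h3⟩ := hI.usedD d hd; exact ⟨j', h0, by omega, h2, h3⟩
      · -- a column ≥ 1: the difference with row 0 is non-zero and fresh
        have hc : (j == 0) = false := by simp [hj0]
        rw [if_neg (by rw [hc]; exact Bool.false_ne_true)] at hs
        have hjj0 : jj ≠ 0 := fun e => hj0 (by simpa [hjj] using congrArg Fin.val e)
        have hr0 : (a 0 jj).val = j - 1 := ha.row0_val jj hjj0
        have hd : (vs + 11 - (j - 1)) % 11 = (a i jj - a 0 jj).val := by rw [← hr0, hvs]; exact diff_val _ _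
        have hd0 : (a i jj - a 0 jj).val ≠ 0 := by
          rw [ne_eq, ZMod.val_eq_zero, sub_eq_zero]; exact ha.ne_of_ne i 0 jj hi hjji hjj0
        have hdD : uD.testBit ((a i jj - a 0 jj).val) = false := by
          cases e : uD.testBit ((a i jj - a 0 jj).val)
          · rfl
          · obtain ⟨j', h0, h1, h2, h3⟩ := hI.usedD _ e
            have hne : j' ≠ jj := fun ee => by rw [ee] at h1; exact lt_irrefl _ h1
            have hj'0 : j' ≠ 0 := fun ee => by rw [ee] at h0; exact absurd h0 (by simp)
            exact absurd (ZMod.val_injective 11 h3) (ha.diff_ne i 0 hi j' jj hne h2 hj'0 hjji hjj0)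
        rw [hd, hdD] at hs
        have hc2 : (((a i jj - a 0 jj).val == 0) || false) = false := by simp [hd0]
        rw [if_neg (by rw [hc2]; exact Bool.false_ne_true)] at hs
        refine walk_mem ha hi f (j + 1) _ _ _ R0 R2 ⟨?_, ?_, ?_⟩ (by omega) hs
        · rw [hI.pv_eq, pack16, hdig]
        · intro v hv
          rw [Nat.testBit_or, Nat.one_shiftLeft, Nat.testBit_two_pow, Bool.or_eq_true, decide_eq_true_eq] at hv
          rcases hv with hv | hv
          · obtain ⟨j', h1, h2, h3⟩ := hI.usedV v hv; exact ⟨j', by omega, h2, h3⟩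
          · exact ⟨jj, by simp [hjj], hjji, by rw [← hv]⟩
        · intro d hd'
          rw [Nat.testBit_or, Nat.one_shiftLeft, Nat.testBit_two_pow, Bool.or_eq_true, decide_eq_true_eq] at hd'
          rcases hd' with hd' | hd'
          · obtain ⟨j', h0, h1, h2, h3⟩ := hI.usedD d hd'; exact ⟨j', h0, by omega, h2, h3⟩
          · exact ⟨jj, by simp [hjj]; omega, by simp [hjj], hjji, by rw [hd']⟩

/-- membership in a `drop/take` slice is membership -/
theorem mem_of_mem_slice {l : List ℕ} {o n x : ℕ} (h : x ∈ (l.drop o).take n) : x ∈ l :=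
  List.mem_of_mem_drop (List.mem_of_mem_take h)

/-- **the packed row `1` of a normal array is listed in `CANDS2`** (forced digits `0, ·`, then the nine walks `walk1_02 … walk1_10`) -/
theorem packRow_one_mem {a : Fin 12 → Fin 12 → ZMod 11} (ha : IsNormal a) : packRow a 1 ∈ CANDS2 := by
  have h10 : (a 1 0).val = 0 := by
    have := ha.col0 (i := 1) (by decide)
    have e : a 1 0 = 0 := by simpa using this
    rw [e, ZMod.val_zero]
  set v2 := (a 1 2).val with hv2
  have hv2lt : v2 < 11 := (a 1 2).val_lt
  have hv2ne0 : v2 ≠ 0 := by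
    intro e
    have : a 1 2 = a 1 0 := ZMod.val_injective 11 (by rw [← hv2, e, h10])
    exact ha.latin 1 2 0 (by decide) (by decide) (by decide) this
  have hv2ne1 : v2 ≠ 1 := by
    intro e
    have h02 : (a 0 2).val = 1 := ha.row0_val 2 (by decide)
    have : a 1 2 = a 0 2 := ZMod.val_injective 11 (by rw [← hv2, e, h02])
    exact ha.ne_of_ne 1 0 2 (by decide) (by decide) (by decide) this
  -- the invariant at column 3
  have hI : WInv a 1 3 (1 ||| (1 <<< v2)) (1 <<< ((v2 + 11 - 1) % 11)) (v2 * 256) := by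
    refine ⟨?_, ?_, ?_⟩
    · simp only [pack16, rowDigit]
      simp [h10, ← hv2]
    · intro v hv
      rw [Nat.testBit_or, Nat.one_shiftLeft, Nat.testBit_two_pow, Bool.or_eq_true, decide_eq_true_eq] at hv
      rcases hv with hv | hv
      · refine ⟨0, by decide, by decide, ?_⟩
        rw [h10]
        rw [show (1 : ℕ) = 2 ^ 0 from rfl, Nat.testBit_two_pow, decide_eq_true_eq] at hv
        exact hv
      · exact ⟨2, by decide, by decide, by rw [← hv2, hv]⟩
    · intro d hd
      rw [Nat.one_shiftLeft, Nat.testBit_two_pow, decide_eq_true_eq] at hd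
      refine ⟨2, by decide, by decide, by decide, ?_⟩
      rw [← hd, ← diff_val, ha.row0_val 2 (by decide), ← hv2]
      rfl
  have key : ∀ L : List ℕ, isSomeNil (walk 1 9 3 (1 ||| (1 <<< v2)) (1 <<< ((v2 + 11 - 1) % 11)) (v2 * 256) L) = true → packRow a 1 ∈ L := by
    intro L h
    cases e : walk 1 9 3 (1 ||| (1 <<< v2)) (1 <<< ((v2 + 11 - 1) % 11)) (v2 * 256) L with
    | none => rw [e] at h; exact absurd h (by simp [isSomeNil])
    | some L' => exact walk_mem ha (i := 1) (by decide) 9 3 _ _ _ L L' hI (by norm_num) e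
  interval_cases v2
  · exact absurd rfl hv2ne0
  · exact absurd rfl hv2ne1
  · exact mem_of_mem_slice (key _ walk1_02)
  · exact mem_of_mem_slice (key _ walk1_03)
  · exact mem_of_mem_slice (key _ walk1_04)
  · exact mem_of_mem_slice (key _ walk1_05)
  · exact mem_of_mem_slice (key _ walk1_06)
  · exact mem_of_mem_slice (key _ walk1_07)
  · exact mem_of_mem_slice (key _ walk1_08)
  · exact mem_of_mem_slice (key _ walk1_09)
  · exact mem_of_mem_slice (key _ walk1_10)

/-- **the packed row `2` of a normal array is listed in `CANDS3`** (forced digits `1, v₁`, then the nine walks `walk2_02 … walk2_10`) -/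
theorem packRow_two_mem {a : Fin 12 → Fin 12 → ZMod 11} (ha : IsNormal a) : packRow a 2 ∈ CANDS3 := by
  have h20 : (a 2 0).val = 1 := by
    have := ha.col0 (i := 2) (by decide)
    have e : a 2 0 = 1 := by
      have e2 : (((2 : Fin 12) : ℕ) : ZMod 11) = 2 := by decide
      rw [e2] at this; linear_combination this
    rw [e]; decide
  set v1 := (a 2 1).val with hv1
  have hv1lt : v1 < 11 := (a 2 1).val_lt
  have hv1ne1 : v1 ≠ 1 := by
    intro e
    have : a 2 1 = a 2 0 := ZMod.val_injective 11 (by rw [← hv1, e, h20])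
    exact ha.latin 2 1 0 (by decide) (by decide) (by decide) this
  have hv1ne0 : v1 ≠ 0 := by
    intro e
    have h01 : (a 0 1).val = 0 := ha.row0_val 1 (by decide)
    have : a 2 1 = a 0 1 := ZMod.val_injective 11 (by rw [← hv1, e, h01])
    exact ha.ne_of_ne 2 0 1 (by decide) (by decide) (by decide) this
  have hI : WInv a 2 2 (2 ||| (1 <<< v1)) (1 <<< ((v1 + 11 - 0) % 11)) (1 + v1 * 16) := by
    refine ⟨?_, ?_, ?_⟩
    · simp only [pack16, rowDigit]
      simp [h20, ← hv1]
    · intro v hv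
      rw [Nat.testBit_or, Nat.one_shiftLeft, Nat.testBit_two_pow, Bool.or_eq_true, decide_eq_true_eq] at hv
      rcases hv with hv | hv
      · refine ⟨0, by decide, by decide, ?_⟩
        rw [h20]
        rw [show (2 : ℕ) = 2 ^ 1 from rfl, Nat.testBit_two_pow, decide_eq_true_eq] at hv
        exact hv
      · exact ⟨1, by decide, by decide, by rw [← hv1, hv]⟩
    · intro d hd
      rw [Nat.one_shiftLeft, Nat.testBit_two_pow, decide_eq_true_eq] at hd
      refine ⟨1, le_rfl, by decide, by decide, ?_⟩
      rw [← hd, ← diff_val, ha.row0_val 1 (by decide), ← hv1]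
      rfl
  have key : ∀ L : List ℕ, isSomeNil (walk 2 10 2 (2 ||| (1 <<< v1)) (1 <<< ((v1 + 11 - 0) % 11)) (1 + v1 * 16) L) = true → packRow a 2 ∈ L := by
    intro L h
    cases e : walk 2 10 2 (2 ||| (1 <<< v1)) (1 <<< ((v1 + 11 - 0) % 11)) (1 + v1 * 16) L with
    | none => rw [e] at h; exact absurd h (by simp [isSomeNil])
    | some L' => exact walk_mem ha (i := 2) (by decide) 10 2 _ _ _ L L' hI (by norm_num) e
  interval_cases v1
  · exact absurd rfl hv1ne0
  · exact absurd rfl hv1ne1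
  · exact mem_of_mem_slice (key _ walk2_02)
  · exact mem_of_mem_slice (key _ walk2_03)
  · exact mem_of_mem_slice (key _ walk2_04)
  · exact mem_of_mem_slice (key _ walk2_05)
  · exact mem_of_mem_slice (key _ walk2_06)
  · exact mem_of_mem_slice (key _ walk2_07)
  · exact mem_of_mem_slice (key _ walk2_08)
  · exact mem_of_mem_slice (key _ walk2_09)
  · exact mem_of_mem_slice (key _ walk2_10)

end Homology12

end Summit.Ventures.DiscreteObjects.PP12
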